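import Summits.BirchSwinnertonDyer.BirchSwinnertonDyer.Theorems.TwoAdicConverseOrdLambdaHalfAtTwoLocInjectiveOfLocOver
import Summits.BirchSwinnertonDyer.BirchSwinnertonDyer.Theorems.TwoAdicConverseOrdLambdaHalfAtTwoShapiroPTDefs
import Literature.NumberTheory.EllipticCurves.Kato2004.PoitouTateShapiroLatticeAtTwo
import HarnessLib

/-!
# Route `TwoAdicConverse` (rung S3), crux `OrdLambdaHalfAtTwo` (item stmt-BirchSwinnertonDyer-19556), line `kato_determinant_greenberg_two`
# (skeleton v4.7): the (PT) memo binder `TwoAdicShapiroPT.ShapiroLatticePoitouTateAtTwoTheta` DERIVED from two Literature named facts —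
# Kato Thm 12.4 (2) (`Kato2004.thm12_4`) and the Poitou–Tate READING at `p = 2` (`Kato2004.poitouTate_shapiroLattice_bdp_two`, GEN 31)

Cell `bsd-2adic`, seat `bsd-2adic-conv-1` GEN 31 (`--supports stmt-BirchSwinnertonDyer-19556 --as helper`).  Pen RC-362 (B) t2: «(PT)'s `∃ L` device is
PACKAGING — THEOREMS-side KERNEL from t1 facts once a `K`-level carrier with `loc_w̄` exists».  This file is that kernel: for the binder's data
(`K` imaginary quadratic with Heegner hypothesis at `2`, the twist model `C • A = W^{(d_K)}`, `w ∣ 2`, cyclotomic `κ, γ`, keys `κK, γK`, `v ∋ 2` with a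
local generator lift, pins `I_W, I_A, J, J_A`, duals `DGr, Dfi`) it produces `u_A := localTwistHom` of the twist equivalence (E1, bijective), the genuine
Shapiro lattice `L := range (IK.locOver J)` with `range_le` / `two_smul_mem` (GEN 30, p694537/p695719), the Poitou–Tate triple `(θ, δ, π)` (conjunct
(1) of the fact) and `loc_injective` under cotorsion (conjunct (2) of the fact + `TwoAdicShapiroLattice.coprod_loc_injective_of_thm12_4_of_locOver_injective`,
p702252: `res ⊕ res^A` injective on the torsion-free carriers of Kato Thm 12.4 (2)).  Hence, in the 4‴ assembly
`TwoAdicThetaSupply.thetaShapiroKatoGreenbergSupplyAtTwo_of_inputs` (p701530), the input `(PT)` is `shapiroLatticePoitouTateAtTwoTheta_of_facts h124 hPTK`.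

HONEST FRAMING.  THEOREMS ONLY; no definition, no named fact minted here, no `sorry`; CONDITIONAL on the two named facts; the crux is NOT proved here; BSD
is not proved by any of this.  PARTITION (D-0054): none — RANK axis S3 × X5@2 stratum (β); closes none.
-/

set_option linter.dupNamespace false
set_option autoImplicit false

noncomputable section

open scoped NumberField
open Field IsDedekindDomain WeierstrassCurve CategoryTheory NumberField
open Literature.NumberTheory.GaloisRepresentations
open Literature.NumberTheory.EllipticCurves Literature.NumberTheory.EllipticCurves.Kato2004
open Literature.NumberTheory.EllipticCurves.Kato2004.EulerSystemValues
open Literature.NumberTheory.EllipticCurves.Castella2018 (AcSelmer.bdpData)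


namespace Summit.BirchSwinnertonDyer.BirchSwinnertonDyer.Theorems.TwoAdicShapiroLattice

open Summit.BirchSwinnertonDyer.BirchSwinnertonDyer.Theorems.TwoAdicShapiroPT

/-- **The (PT) binder from print: `Kato2004.thm12_4 → Kato2004.poitouTate_shapiroLattice_bdp_two → ShapiroLatticePoitouTateAtTwoTheta`.**  The split datum
`hD` at `2` (2-adic Hensel, GEN 30), `κ ∘ res_{K/ℚ}` onto (`√2 ∉ K`), the twist equivalence `u` (E1) and its local untwisting `u_A`, a `K`-pin `IK`
(`nonempty_iwasawaH1DataOver`), `L := range locOver` with the two lattice clauses (GEN 30), then conjuncts (1)/(2) of the Poitou–Tate fact, the latter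
upgraded to the binder's `loc_injective` by p702252 + Kato Thm 12.4 (2). [cite: Nekovar2006, 8.9.6.1–8.9.6.2 (p. 240)] [cite: Greenberg2010, Prop. 3.1.1]
[cite: Kato2004Asterisque, Thm 12.4 (2) (p. 221), §17.13 (17.13.1)–(17.13.2) (p. 279)] [cite: GreenbergLNM1716, §4 p. 107] -/
theorem shapiroLatticePoitouTateAtTwoTheta_of_facts (h124 : Kato2004.thm12_4) (hPTK : Kato2004.poitouTate_shapiroLattice_bdp_two) :
    ShapiroLatticePoitouTateAtTwoTheta := by
  intro W _ _ K _ _ hK hH A _ _ C hA w hw κ γ hκ hγ κK γK hκK hγK v hv γᵥ hsurj hγᵥ I_W I_A J J_A DGr Dfi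
  haveI : ContinuousSMul ℤ_[2] ((W.baseChange K).tateModule 2) := TateModule.continuousSMul_padicInt
  haveI : (galRange (K := ℚ) K).Normal := normal_galRange_of_finrank_eq_two K hK.1
  have hsplit : ((Ideal.span {(2 : ℤ)}).primesOver (𝓞 K)).ncard = 2 := by
    have := hH 2 Nat.prime_two (dvd_refl 2)
    simpa using this
  have hD : ∀ g : absoluteGaloisGroup (v.adicCompletion ℚ),
      resGalOfEmb (closureEmb (K := ℚ) (v.adicCompletion ℚ)) g ∈ galRange (K := ℚ) K :=
    resGalOfEmb_mem_galRange_of_split_two hK.1 hsplit (primesEquiv_eq_two_of_mem hv)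
  have h := surjective_comp_absGaloisRestrict_two K hK κ hκ
  obtain ⟨u, hu, hu', hu₁, hu₂⟩ := exists_twist_equiv K 2 hK.1 W A C hA
  obtain ⟨γK', hγK'⟩ := ZpExtension.exists_isTopGenerator (κ.restrict K h)
  obtain ⟨IK⟩ := nonempty_iwasawaH1DataOver (V := W.baseChange K) (p := 2) (κ := κ.restrict K h) hγK'
  have hbij : Function.Bijective (localTwistHom v hD W A u hu hu₁).hom := by
    have hcoe : ⇑(localTwistHom v hD W A u hu hu₁).hom = ⇑u := funext fun x ↦ localTwistHom_hom_apply v hD W A u hu hu₁ x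
    rw [hcoe]
    exact u.bijective
  obtain ⟨⟨θ, θ_C, δ, π, hδ, hπ, hex⟩, hinj⟩ :=
    hPTK W K hK w hw κ γ hκ hγ h γK' hγK' κK γK hκK hγK v hv hD γᵥ hsurj hγᵥ IK J DGr Dfi
  exact ⟨localTwistHom v hD W A u hu hu₁, hbij, LinearMap.range (IK.locOver J hD hsurj hγK' hγᵥ),
    IK.range_coprod_loc_le_range_locOver u hu hu₁ I_A J J_A I_W hsurj hγ hγK' hγᵥ,
    fun y hy ↦ IK.two_smul_mem_range_coprod_loc_of_mem_range_locOver u hu hu' hu₁ hu₂ I_A J J_A I_W hsurj hγ hγK' hγᵥ hy,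
    ⟨θ, θ_C, δ, π, hδ, hπ, hex⟩,
    fun hfin htors ↦ coprod_loc_injective_of_thm12_4_of_locOver_injective h124 hK hκ u hu hu' hu₁ hu₂ hγ hγK' hsurj hγᵥ
      I_W I_A IK J J_A (hinj hfin htors)⟩

end Summit.BirchSwinnertonDyer.BirchSwinnertonDyer.Theorems.TwoAdicShapiroLattice

end
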